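import Literature.Analysis.FunctionSpaces.ContDiffHolderNemytskii
import Literature.Analysis.FunctionSpaces.ContDiffHolderDiffOperator
import Literature.Analysis.FunctionSpaces.ContDiffHolderExp
import Literature.Analysis.FunctionSpaces.HolderChartRestriction
import Literature.Analysis.FunctionSpaces.HolderManifoldLaplacian
import Literature.Analysis.FunctionSpaces.HolderManifoldMollify
import HarnessLib

/-!
# Fully nonlinear second-order operators are smooth maps `ℝ × C^{2,r}_𝔄(M) → C^{0,r}_𝔄(M)`
# (Hölder spaces, Nemytskii operators through the charts)

Topic `Literature/Analysis/FunctionSpaces`. Let `𝔄` be Hölder chart data on a compact manifold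
`M` (part 4, `HolderSpaceManifold.lean`) and suppose that in every chart `j` we are given a smooth
**structure function** `𝒩ⱼ(t, c, J)` of a real parameter `t`, of a point `c` of a
finite-dimensional coefficient space `F₁` and of a coordinate `2`-jet
`J = (v, p, r) ∈ ℝ × E* × (E →L E →L ℝ)`, together with a coefficient function
`Cⱼ ∈ C^{0,r}_b(E, F₁)` (typically: the frozen geometric coefficients of the chart, cut off near
the chart piece). Then

* `exists_contDiff_chartNemytskii` — in ONE chart, `(t, v) ↦ (y ↦ a(y)·𝒩(t, C(y), v(y), Dv(y),
  D²v(y)))` is a `C^∞` map `ℝ × C^{2,r}_b(E, ℝ) → C^{0,r}_b(E, ℝ)` for every smooth compactly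
  supported weight `a` (the jet map `v ↦ (v, Dv, D²v)` is bounded linear into `C^{0,r}_b`, parts 12–13;
  post-composition with the smooth `𝒩` is `C^∞`, part 26 `ContDiffHolderFunction.contDiff_compLeft`;
  multiplication by `a` is bounded linear, part 13 `coeffCLM`);
* `exists_contDiff_manifoldNemytskii` — ON THE MANIFOLD, patching with the chart restriction /
  extension operators of part 11 (`chartRestrictCLM`, `chartExtendCLM`) and the weights
  `ρ̂ⱼ = 𝔄.piece 1 j`: there is a `C^∞` map `Φ : ℝ × C^{2,r}_𝔄(M, ℝ) → C^{0,r}_𝔄(M, ℝ)` with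
  `Φ(t, w)(x) = Σⱼ ρⱼ(x) · 𝒩ⱼ(t, Cⱼ(chartⱼ x), w(x), D ŵⱼ(chartⱼ x), D² ŵⱼ(chartⱼ x))`,
  `ŵⱼ = w ∘ chartⱼ⁻¹` — so that when every `𝒩ⱼ(t, Cⱼ(y), J² ŵⱼ(y))` computes the same scalar
  `F_t(w)(chartⱼ⁻¹ y)` on the `j`-th chart piece, `Φ(t, w) = F_t(w)` (`Σⱼ ρⱼ = 1`).

This is the standard way a fully nonlinear differential operator with smooth structure becomes a
smooth map of Hölder–Banach spaces, as used before every application of the implicit function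
theorem in `C^{2,α} × ℝ → C^{α}` (Gilbarg–Trudinger 2001, §17.2, proof of Thm. 17.6 ff.).
Everything is proved; no definitions, no named facts (the maps are produced existentially).

## References

* D. Gilbarg, N. S. Trudinger, *Elliptic Partial Differential Equations of Second Order* (2001),
  §17.2. [GilbargTrudinger2001]
-/

noncomputable section

open Set Function Filter
open scoped NNReal ContDiff Topology Manifold

namespace Literature.Analysis.FunctionSpaces

-- spaces of iterated continuous linear maps need a deeper instance search (as in part 26)
set_option maxSynthPendingDepth 3

/-! ### One chart -/

section Chart

variable {E : Type} [NormedAddCommGroup E] [NormedSpace ℝ E] [FiniteDimensional ℝ E]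
  {F₁ : Type} [NormedAddCommGroup F₁] [NormedSpace ℝ F₁] [FiniteDimensional ℝ F₁] {r : ℝ≥0}

omit [FiniteDimensional ℝ E] in
/-- The constant function `const 1` scaled by `t`: value `t`. [folklore] -/
theorem smul_const_one_apply (t : ℝ) (x : E) :
    ((t • (ContDiffHolderFunction.const (1 : ℝ) : ContDiffHolderFunction E ℝ 0 r) :
      ContDiffHolderFunction E ℝ 0 r) : E → ℝ) x = t := by
  rw [ContDiffHolderFunction.coe_smul, Pi.smul_apply, ContDiffHolderFunction.const_apply,
    smul_eq_mul, mul_one]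

/-- **The chart Nemytskii operator of a smooth structure function is `C^∞`.** For a smooth
`𝒩 : ℝ × (F₁ × (ℝ × (E* × (E →L E →L ℝ)))) → ℝ`, a coefficient function `C ∈ C^{0,r}_b(E, F₁)` and a
smooth compactly supported weight `a`, there is a `C^∞` map
`M : ℝ × C^{2,r}_b(E, ℝ) → C^{0,r}_b(E, ℝ)` with
`M(t, v)(y) = a(y) · 𝒩(t, C(y), v(y), Dv(y), D²v(y))` (`0 ≤ r ≤ 1`).
[cite: GilbargTrudinger2001, §17.2] -/
theorem exists_contDiff_chartNemytskii (hr : r ≤ 1)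
    (𝒩 : ℝ × (F₁ × (ℝ × ((E →L[ℝ] ℝ) × (E →L[ℝ] E →L[ℝ] ℝ)))) → ℝ) (h𝒩 : ContDiff ℝ ∞ 𝒩)
    (C : ContDiffHolderFunction E F₁ 0 r) (a : E → ℝ) (ha : ContDiff ℝ ∞ a)
    (has : HasCompactSupport a) :
    ∃ M : ℝ × ContDiffHolderFunction E ℝ 2 r → ContDiffHolderFunction E ℝ 0 r,
      ContDiff ℝ ∞ M ∧ ∀ (t : ℝ) (v : ContDiffHolderFunction E ℝ 2 r) (y : E),
        M (t, v) y = a y * 𝒩 (t, C y, v y, fderiv ℝ (v : E → ℝ) y,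
          fderiv ℝ (fderiv ℝ (v : E → ℝ)) y) := by
  -- the jet map `v ↦ (v, Dv, D²v)` as a bounded linear map into `C^{0,r}_b(E, jets)`
  let J : ContDiffHolderFunction E ℝ 2 r →L[ℝ]
      ContDiffHolderFunction E (ℝ × ((E →L[ℝ] ℝ) × (E →L[ℝ] E →L[ℝ] ℝ))) 0 r :=
    (ContDiffHolderFunction.postcompCLM (ContinuousLinearMap.inl ℝ ℝ _)).comp
        (ContDiffHolderFunction.incl₂CLM hr) +
      (ContDiffHolderFunction.postcompCLM (ContinuousLinearMap.inr ℝ ℝ _)).comp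
        ((ContDiffHolderFunction.postcompCLM (ContinuousLinearMap.inl ℝ (E →L[ℝ] ℝ) _)).comp
            ((ContDiffHolderFunction.inclCLM hr).comp ContDiffHolderFunction.fderivCLM) +
          (ContDiffHolderFunction.postcompCLM (ContinuousLinearMap.inr ℝ (E →L[ℝ] ℝ) _)).comp
            ContDiffHolderFunction.fderiv₂CLM)
  have hJ : ∀ (v : ContDiffHolderFunction E ℝ 2 r) (y : E),
      J v y = (v y, fderiv ℝ (v : E → ℝ) y, fderiv ℝ (fderiv ℝ (v : E → ℝ)) y) := by
    intro v y
    simp only [J, _root_.add_apply, ContinuousLinearMap.comp_apply,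
      ContDiffHolderFunction.coe_add, Pi.add_apply, ContDiffHolderFunction.postcompCLM_apply,
      ContDiffHolderFunction.incl₂CLM_apply, ContDiffHolderFunction.inclCLM_apply,
      ContDiffHolderFunction.fderivCLM_apply, ContDiffHolderFunction.fderiv₂CLM_apply,
      ContinuousLinearMap.inl_apply, ContinuousLinearMap.inr_apply, Prod.mk_add_mk, add_zero,
      zero_add]
  -- the tuple map `(t, v) ↦ (t, C, J v)` into `C^{0,r}_b(E, T)`
  let U : ℝ × ContDiffHolderFunction E ℝ 2 r →
      ContDiffHolderFunction E (ℝ × (F₁ × (ℝ × ((E →L[ℝ] ℝ) × (E →L[ℝ] E →L[ℝ] ℝ))))) 0 r := fun p =>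
    ContDiffHolderFunction.postcompCLM (ContinuousLinearMap.inl ℝ ℝ (F₁ × (ℝ × ((E →L[ℝ] ℝ) × (E →L[ℝ] E →L[ℝ] ℝ)))))
        (p.1 • (ContDiffHolderFunction.const (1 : ℝ) : ContDiffHolderFunction E ℝ 0 r)) +
      ContDiffHolderFunction.postcompCLM (ContinuousLinearMap.inr ℝ ℝ (F₁ × (ℝ × ((E →L[ℝ] ℝ) × (E →L[ℝ] E →L[ℝ] ℝ)))))
        (ContDiffHolderFunction.postcompCLM (ContinuousLinearMap.inl ℝ F₁ (ℝ × ((E →L[ℝ] ℝ) × (E →L[ℝ] E →L[ℝ] ℝ)))) C +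
          ContDiffHolderFunction.postcompCLM (ContinuousLinearMap.inr ℝ F₁ (ℝ × ((E →L[ℝ] ℝ) × (E →L[ℝ] E →L[ℝ] ℝ)))) (J p.2))
  have hU : ∀ (t : ℝ) (v : ContDiffHolderFunction E ℝ 2 r) (y : E),
      U (t, v) y = (t, C y, v y, fderiv ℝ (v : E → ℝ) y, fderiv ℝ (fderiv ℝ (v : E → ℝ)) y) := by
    intro t v y
    simp only [U, ContDiffHolderFunction.coe_add, Pi.add_apply,
      ContDiffHolderFunction.postcompCLM_apply, smul_const_one_apply, hJ,
      ContinuousLinearMap.inl_apply, ContinuousLinearMap.inr_apply, Prod.mk_add_mk, add_zero,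
      zero_add]
  have hUs : ContDiff ℝ ∞ U := by
    refine ((ContDiffHolderFunction.postcompCLM _).contDiff.comp
      (contDiff_fst.smul contDiff_const)).add
      ((ContDiffHolderFunction.postcompCLM _).contDiff.comp (contDiff_const.add
        ((ContDiffHolderFunction.postcompCLM _).contDiff.comp (J.contDiff.comp contDiff_snd))))
  -- the Nemytskii operator of `𝒩` and the weight
  obtain ⟨hN, -⟩ := ContDiffHolderFunction.contDiff_compLeft (E := E) (k := 0) hr 𝒩 h𝒩
  refine ⟨fun p => ContDiffHolderFunction.coeffCLM hr a ha has
      (ContDiffHolderFunction.compLeft hr 𝒩 (h𝒩.of_le (by exact_mod_cast le_top)) (U p)),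
    (ContDiffHolderFunction.coeffCLM hr a ha has).contDiff.comp (hN.comp hUs), fun t v y => ?_⟩
  rw [ContDiffHolderFunction.coeffCLM_apply, ContDiffHolderFunction.compLeft_apply, hU,
    smul_eq_mul]

end Chart

/-! ### On the manifold -/

section Manifold

variable {ι : Type} [Fintype ι] {E : Type} [NormedAddCommGroup E] [NormedSpace ℝ E]
  [FiniteDimensional ℝ E] {M : Type*} [TopologicalSpace M] [ChartedSpace E M]
  [IsManifold 𝓘(ℝ, E) ∞ M] [CompactSpace M] [T2Space M] (𝔄 : HolderChartData ι E M)
  {F₁ : Type} [NormedAddCommGroup F₁] [NormedSpace ℝ F₁] [FiniteDimensional ℝ F₁] {r : ℝ≥0}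

omit [Fintype ι] [IsManifold 𝓘(ℝ, E) ∞ M] [T2Space M] in
/-- On the `j`-th chart piece the cutoff `𝔄.cutoff j` is `1` near `chart_j x` whenever
`ρ_j x ≠ 0`. [folklore] -/
theorem HolderChartData.cutoff_eventuallyEq_one {j : ι} {x : M} (hx : 𝔄.ρ j x ≠ 0) :
    (𝔄.cutoff j) =ᶠ[𝓝 (𝔄.chart j x)] fun _ => (1 : ℝ) := by
  have hxs : x ∈ (𝔄.chart j).source := by
    by_contra h
    exact hx (𝔄.ρ_eq_zero h)
  have hK : 𝔄.chart j x ∈ 𝔄.chart j '' tsupport (𝔄.ρ j) :=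
    ⟨x, subset_closure (mem_support.2 hx), rfl⟩
  exact (𝔄.cutoff_eq_one j).filter_mono (nhds_le_nhdsSet hK)

omit [T2Space M] in
/-- The chart restriction `η_j · (w ∘ chart_j⁻¹)` agrees with `w ∘ chart_j⁻¹` near `chart_j x`
whenever `ρ_j x ≠ 0`. [folklore] -/
theorem chartRestrictCLM_eventuallyEq (hr : r ≤ 1) {k : ℕ} (w : HolderManifoldFunction 𝔄 ℝ k r)
    {j : ι} {x : M} (hx : 𝔄.ρ j x ≠ 0) :
    ((chartRestrictCLM 𝔄 hr j (𝔄.cutoff j) (𝔄.contDiff_cutoff j)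
        (𝔄.hasCompactSupport_cutoff j) (𝔄.tsupport_cutoff_subset j) w :
          ContDiffHolderFunction E ℝ k r) : E → ℝ) =ᶠ[𝓝 (𝔄.chart j x)]
      fun y => w ((𝔄.chart j).symm y) := by
  filter_upwards [𝔄.cutoff_eventuallyEq_one hx] with y hy
  rw [chartRestrictCLM_apply, hy, one_smul]

/-- **A family of smooth chart structure functions defines a `C^∞` map
`ℝ × C^{2,r}_𝔄(M) → C^{0,r}_𝔄(M)`** (see the module docstring): there is `Φ`, `C^∞` jointly in
`(t, w)`, with `Φ(t, w)(x) = Σⱼ ρⱼ(x)·𝒩ⱼ(t, Cⱼ(chartⱼ x), w x, D ŵⱼ(chartⱼ x), D² ŵⱼ(chartⱼ x))`,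
`ŵⱼ = w ∘ chartⱼ⁻¹`. [cite: GilbargTrudinger2001, §17.2] -/
theorem exists_contDiff_manifoldNemytskii (hr : r ≤ 1)
    (𝒩 : ι → ℝ × (F₁ × (ℝ × ((E →L[ℝ] ℝ) × (E →L[ℝ] E →L[ℝ] ℝ)))) → ℝ)
    (h𝒩 : ∀ j, ContDiff ℝ ∞ (𝒩 j)) (C : ι → ContDiffHolderFunction E F₁ 0 r) :
    ∃ Φ : ℝ × HolderManifoldFunction 𝔄 ℝ 2 r → HolderManifoldFunction 𝔄 ℝ 0 r,
      ContDiff ℝ ∞ Φ ∧ ∀ (t : ℝ) (w : HolderManifoldFunction 𝔄 ℝ 2 r) (x : M),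
        Φ (t, w) x = ∑ j, 𝔄.ρ j x * 𝒩 j (t, C j (𝔄.chart j x), w x,
          fderiv ℝ (fun y => w ((𝔄.chart j).symm y)) (𝔄.chart j x),
          fderiv ℝ (fderiv ℝ (fun y => w ((𝔄.chart j).symm y))) (𝔄.chart j x)) := by
  classical
  -- the chart maps of `exists_contDiff_chartNemytskii` with weights `ρ̂ⱼ = piece 1 j`
  have hρ : ∀ j, ContDiff ℝ ∞ (𝔄.piece (fun _ : M => (1 : ℝ)) j) := fun j =>
    𝔄.contDiff_piece contMDiff_const j
  have hρc : ∀ j, HasCompactSupport (𝔄.piece (fun _ : M => (1 : ℝ)) j) := fun j =>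
    𝔄.hasCompactSupport_piece _ j
  choose Mc hMc hMc_eq using fun j =>
    exists_contDiff_chartNemytskii (E := E) hr (𝒩 j) (h𝒩 j) (C j) _ (hρ j) (hρc j)
  -- restriction, chart map, extension, summed over the charts
  let R : ι → HolderManifoldFunction 𝔄 ℝ 2 r →L[ℝ] ContDiffHolderFunction E ℝ 2 r := fun j =>
    chartRestrictCLM 𝔄 hr j (𝔄.cutoff j) (𝔄.contDiff_cutoff j) (𝔄.hasCompactSupport_cutoff j)
      (𝔄.tsupport_cutoff_subset j)
  let X : ι → ContDiffHolderFunction E ℝ 0 r →L[ℝ] HolderManifoldFunction 𝔄 ℝ 0 r := fun j =>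
    chartExtendCLM 𝔄 hr j (𝔄.cutoff j) (𝔄.contDiff_cutoff j) (𝔄.hasCompactSupport_cutoff j)
      (𝔄.tsupport_cutoff_subset j)
  refine ⟨fun p => ∑ j, X j (Mc j (p.1, R j p.2)), ?_, fun t w x => ?_⟩
  · exact ContDiff.sum fun j _ =>
      (X j).contDiff.comp ((hMc j).comp (contDiff_fst.prodMk ((R j).contDiff.comp contDiff_snd)))
  · rw [HolderManifoldFunction.coe_finset_sum]
    refine Finset.sum_congr rfl fun j _ => ?_
    by_cases hx : 𝔄.ρ j x = 0
    · -- off the `j`-th piece both sides vanish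
      rw [hx, zero_mul]
      change X j (Mc j (t, R j w)) x = 0
      rw [chartExtendCLM_apply]
      by_cases hxs : x ∈ (𝔄.chart j).source
      · rw [HolderChartData.extendByZero_apply_of_mem _ j _ hxs, hMc_eq, smul_eq_mul]
        have h1 : 𝔄.piece (fun _ : M => (1 : ℝ)) j (𝔄.chart j x) = 𝔄.ρ j x := by
          rw [← 𝔄.smul_apply_eq_piece _ hxs, smul_eq_mul, mul_one]
        rw [h1, hx, zero_mul, mul_zero]
      · rw [HolderChartData.extendByZero_apply_of_not_mem _ j _ hxs]
    · -- on the piece: the cutoff is `1` near `chart_j x` and the restriction is `w ∘ chart_j⁻¹`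
      have hxs : x ∈ (𝔄.chart j).source := by
        by_contra h
        exact hx (𝔄.ρ_eq_zero h)
      have h1 : 𝔄.piece (fun _ : M => (1 : ℝ)) j (𝔄.chart j x) = 𝔄.ρ j x := by
        rw [← 𝔄.smul_apply_eq_piece _ hxs, smul_eq_mul, mul_one]
      have hη : 𝔄.cutoff j (𝔄.chart j x) = 1 := (𝔄.cutoff_eventuallyEq_one hx).self_of_nhds
      have hR : ((R j w : ContDiffHolderFunction E ℝ 2 r) : E → ℝ) =ᶠ[𝓝 (𝔄.chart j x)]
          fun y => w ((𝔄.chart j).symm y) := chartRestrictCLM_eventuallyEq 𝔄 hr w hx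
      have hR0 : (R j w : ContDiffHolderFunction E ℝ 2 r) (𝔄.chart j x) = w x := by
        rw [hR.self_of_nhds]
        exact congrArg w ((𝔄.chart j).left_inv hxs)
      have hR1 : fderiv ℝ ((R j w : ContDiffHolderFunction E ℝ 2 r) : E → ℝ) (𝔄.chart j x) =
          fderiv ℝ (fun y => w ((𝔄.chart j).symm y)) (𝔄.chart j x) := hR.fderiv_eq
      have hR2 : fderiv ℝ (fderiv ℝ ((R j w : ContDiffHolderFunction E ℝ 2 r) : E → ℝ))
          (𝔄.chart j x) = fderiv ℝ (fderiv ℝ (fun y => w ((𝔄.chart j).symm y))) (𝔄.chart j x) :=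
        hR.fderiv.fderiv_eq
      change X j (Mc j (t, R j w)) x = _
      rw [chartExtendCLM_apply, HolderChartData.extendByZero_apply_of_mem _ j _ hxs, hMc_eq,
        smul_eq_mul, hη, one_mul, h1, hR0, hR1, hR2]

end Manifold

end Literature.Analysis.FunctionSpaces

end
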